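import Summits.CriticalPhenomena.PercolationContinuityZ3.Theorems.PercNearOneGluingNoHeavyQuantResidRecursion
import HarnessLib

/-!
# QUANT lane R8, T-DEC: THE LAW-LEVEL PEEL STEP — DEC of the smaller canonical residual and of the U-part give DEC of the canonical residual
# of `s :: L′` (the recursion `…QuantResidRecursion` + `convClosedT_holds` + `decAtT_mixture`); inside `LightResidDECOracle` the U-part is
# what is left (arm-1 gen 52, architect)

builds on p205010 (kernel theorem, internal audit signed; external expert review pending)

Support file (`--supports stmt-CriticalPhenomena-4575`), QUANT lane seat prim-quant-arm-1 (gen 52, architect); memo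
`run/shared/lean/prim/quant/prim-quant-arm-1-g52/ARCH-G52.md` §3.1.  Theorems only, standard axioms, no sorries.  Sequel of `…QuantResidRecursion`
(`resid_cons_recursion`: `(1 − w)·R_{s::L′} = (r − w)·[tᵃ ∗ R_{L′}] + (1 − r)·gate_{aq}(ρ ∗ H)`, `H = (flaw L′ − (1−q)δ₀)/q`).

THE STEP (`decAt_resid_cons_of_upart`).  Law-OK `s :: L′` (`L′` with at least two members), `0 < a < 1`, canonical weights
(`wco a (s :: L′) = rfac a s · wco a L′`, e.g. by `rfac_mul_wco_le_rprod`/`wco_cons_eq_rfac_mul` when the second root gate is at most the first),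
the HEAVY-SINGLE condition `1 − s.q ≤ flaw L′ 0`, a floor `0 < y < 1` affordable by the scaled tree and by the smaller residual: if `gate ρ (a q)` is
DEC at `y` below `M_s`, `resid a (wco a L′) L′` is DEC at `y` below `ftop L′`, and the U-part `gate_{aq}(ρ ∗ H)` is DEC at `y` below `M_s + ftop L′`,
then `resid a (wco a (s :: L′)) (s :: L′)` is DEC at `y` at every layer below its top.  In `LightResidDECOracle` (floor `y = min (a x) (1/2)`) the
first input is the member's light oracle, the second the induction on the width, and the third — the U-part, arm-1 g47's conditioned-compound law in
the heavy-single orientation — is the open content; for width 3 with a balanced light pair it is a mixture of oracle-legal forests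
(`…QuantThreeRootHeavySingleStep/Oracle`).  `openedCompound_laws`: `H` is a probability law on `{0..ftop L′}` of mean `fmean L′ / q`.

HONEST STATUS: a reduction, not a proof of the node; `LightResidDECOracle`, `LightResidDEC`, `LightSiblingStep`, `FarTreeRow` OPEN; RATE class log\*
/ honest sentence of `run/shared/lean/prim/quant/README.md` unchanged.  [this work]; ConvClosedT: census-2 g60; mixtures: prim-quant-stmt g19.
Nothing here is cited as a published result.  The gluing rows served [cite: KozmaNitzan2024, Conjecture 3 (p. 15)]; product measure
[cite: Grimmett1999, §1.3 p. 10].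
-/

noncomputable section

open scoped BigOperators

namespace Summit.CriticalPhenomena.PercolationContinuityZ3.Theorems
namespace Quant
namespace LawDec

open Finset

/-! ### The law-level peel step: DEC of the smaller residual and of the U-part give DEC of the residual -/

/-- law facts of the opened compound `H k = (G k − (1−q)[k=0])/q` of a probability law `G` on `{0..M}` with `G 0 ≥ 1 − q`, `0 < q`:
nonnegative, vanishing above `M`, mass `1`, mean `(mean G)/q`. [this work] -/
theorem openedCompound_laws (q : ℝ) (G : ℕ → ℝ) (M : ℕ) (hq0 : 0 < q) (hG0 : ∀ h, 0 ≤ G h) (hGM : ∀ h, M < h → G h = 0)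
    (hG1 : ∑ h ∈ Finset.range (M + 1), G h = 1) (hGq : 1 - q ≤ G 0) :
    (∀ h, 0 ≤ (fun k => (G k - (1 - q) * (if k = 0 then (1 : ℝ) else 0)) / q) h) ∧
    (∀ h, M < h → (fun k => (G k - (1 - q) * (if k = 0 then (1 : ℝ) else 0)) / q) h = 0) ∧
    (∑ h ∈ Finset.range (M + 1), (fun k => (G k - (1 - q) * (if k = 0 then (1 : ℝ) else 0)) / q) h = 1) ∧
    (∑ h ∈ Finset.range (M + 1), (h : ℝ) * (fun k => (G k - (1 - q) * (if k = 0 then (1 : ℝ) else 0)) / q) h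
      = (∑ h ∈ Finset.range (M + 1), (h : ℝ) * G h) / q) := by
  refine ⟨fun h => ?_, fun h hh => openedCompound_eq_zero q G M hGM h hh, ?_, ?_⟩
  · show 0 ≤ (G h - (1 - q) * (if h = 0 then (1 : ℝ) else 0)) / q
    refine div_nonneg ?_ hq0.le
    by_cases hh : h = 0
    · subst hh; rw [if_pos rfl]; linarith
    · rw [if_neg hh, mul_zero, sub_zero]; exact hG0 h
  · show ∑ h ∈ Finset.range (M + 1), (G h - (1 - q) * (if h = 0 then (1 : ℝ) else 0)) / q = 1
    rw [← Finset.sum_div, Finset.sum_sub_distrib, hG1, ← Finset.mul_sum, Finset.sum_ite_eq' (Finset.range (M + 1)) 0,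
      if_pos (Finset.mem_range.2 (Nat.succ_pos M))]
    field_simp
    ring
  · show ∑ h ∈ Finset.range (M + 1), (h : ℝ) * ((G h - (1 - q) * (if h = 0 then (1 : ℝ) else 0)) / q) = _
    have e : ∀ h : ℕ, (h : ℝ) * ((G h - (1 - q) * (if h = 0 then (1 : ℝ) else 0)) / q) = ((h : ℝ) * G h) / q := by
      intro h
      by_cases hh : h = 0
      · subst hh; simp
      · rw [if_neg hh, mul_zero, sub_zero]; ring
    rw [Finset.sum_congr rfl fun h _ => e h, Finset.sum_div]

/-- **THE LAW-LEVEL PEEL STEP.**  Law-OK `s :: L′` (`L′` with `≥ 2` members), `0 < a < 1`, the canonical-weight identity `wco a (s :: L′) = rfac a s·wco a L′`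
(`rfac_mul_wco_le_rprod` / `wco_cons_eq_rfac_mul`), the HEAVY-SINGLE condition `1 − s.q ≤ flaw L′ 0` (the compound's "some root open" probability is
at most `s.q`), a floor `0 < y < 1` affordable by the scaled tree and by the smaller residual (`y·M_s ≤ a q·mean ρ`, `y·ftop L′ ≤ a·fmean L′`): IF the
scaled tree `gate ρ (a q)` is DEC at `y` at every layer below `M_s`, the smaller canonical residual `resid a (wco a L′) L′` is DEC at `y` at every layer
below `ftop L′`, AND the U-part `gate_{a q}(ρ ∗ H)` (`H = (flaw L′ − (1−q)δ₀)/q`) is DEC at `y` at every layer below `M_s + ftop L′`, THEN the canonical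
residual of `s :: L′` is DEC at `y` at every layer below its top (`resid_cons_recursion` + `convClosedT_holds` + `decAtT_mixture`).  Inside
`LightResidDECOracle` the first two inputs are the oracle and the induction on the width; the U-part is what is left. [this work] -/
theorem decAt_resid_cons_of_upart {a y : ℝ} (ha0 : 0 < a) (ha1 : a < 1) (s t u : Sib) (L₂ : List Sib) (hs : s.LawOK)
    (hL' : ∀ v ∈ t :: u :: L₂, v.LawOK) (hwco : wco a (s :: t :: u :: L₂) = rfac a s * wco a (t :: u :: L₂))
    (hH0 : 1 - s.q ≤ flaw (t :: u :: L₂) 0) (hy0 : 0 < y) (hy1 : y < 1)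
    (hta_s : y * (s.M : ℝ) ≤ a * s.q * s.mean) (hta' : y * (ftop (t :: u :: L₂) : ℝ) ≤ a * fmean (t :: u :: L₂))
    (hDs : ∀ j, j < s.M → DECAt y j s.M (gate s.ρ (a * s.q)))
    (hD' : ∀ j, j < ftop (t :: u :: L₂) → DECAt y j (ftop (t :: u :: L₂)) (resid a (wco a (t :: u :: L₂)) (t :: u :: L₂)))
    (hU : ∀ j, j < s.M + ftop (t :: u :: L₂) → DECAt y j (s.M + ftop (t :: u :: L₂))
      (gate (lconv s.M (ftop (t :: u :: L₂)) s.ρ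
        (fun k => (flaw (t :: u :: L₂) k - (1 - s.q) * (if k = 0 then (1 : ℝ) else 0)) / s.q)) (a * s.q)))
    (j : ℕ) (hj : j < ftop (s :: t :: u :: L₂)) :
    DECAt y j (ftop (s :: t :: u :: L₂)) (resid a (wco a (s :: t :: u :: L₂)) (s :: t :: u :: L₂)) := by
  set L' : List Sib := t :: u :: L₂ with hL'def
  set H : ℕ → ℝ := fun k => (flaw L' k - (1 - s.q) * (if k = 0 then (1 : ℝ) else 0)) / s.q with hH
  obtain ⟨hq0, hq1, ρ0, ρM, ρ1⟩ := hs
  have haq0 : 0 < a * s.q := mul_pos ha0 hq0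
  have haq1 : a * s.q < 1 := by nlinarith
  obtain ⟨f0, fM, f1, fmn⟩ := flaw_facts L' hL'
  have hsL : ∀ v ∈ s :: L', v.LawOK := by
    intro v hv
    rcases List.mem_cons.1 hv with rfl | hv'
    · exact ⟨hq0, hq1, ρ0, ρM, ρ1⟩
    · exact hL' v hv'
  have hw'1 : wco a L' < 1 := wco_lt_one ha1 t u L₂ hL'
  have hw1 : wco a (s :: L') < 1 := wco_lt_one ha1 s t (u :: L₂) hsL
  obtain ⟨hW'0, _, _⟩ := wco_facts ha1.le L' hL'
  obtain ⟨hr0, hr1, _, _, _⟩ := rfac_facts ha1.le (hsL s List.mem_cons_self)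
  obtain ⟨_, hW'1, _⟩ := wco_facts ha1.le L' hL'
  have hrw : wco a (s :: L') ≤ rfac a s := by
    have e1 : wco a (s :: L') = rfac a s * wco a L' := hwco
    rw [e1]; exact mul_le_of_le_one_right hr0.le hW'1
  set w : ℝ := wco a (s :: L') with hwdef
  set r : ℝ := rfac a s with hrdef
  -- laws
  obtain ⟨g0, gM, g1⟩ := gate_laws s.M s.ρ (a * s.q) haq0.le haq1.le ρ0 ρM ρ1
  obtain ⟨R0, RM, R1, Rmn⟩ := resid_laws ha0 ha1.le L' hL' le_rfl hw'1
  obtain ⟨H0, HM, H1, Hmn⟩ := openedCompound_laws s.q (flaw L') (ftop L') hq0 f0 fM f1 hH0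
  rw [fmn] at Hmn
  obtain ⟨RR0, RRM, RR1, RRmn⟩ := resid_laws ha0 ha1.le (s :: L') hsL le_rfl hw1
  set T : ℝ := a * fmean (s :: L') with hTdef
  have hTeq : T = a * s.q * s.mean + a * fmean L' := by
    rw [hTdef]; show a * (fmean L' + s.q * s.mean) = _; ring
  -- component 1: the scaled tree beside the smaller residual — ConvClosedT
  have hconv : DECAtT y T j (s.M + ftop L') (lconv s.M (ftop L') (gate s.ρ (a * s.q)) (resid a (wco a L') L')) := by
    have hj' : j < s.M + ftop L' := by
      have : ftop (s :: L') = ftop L' + s.M := rfl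
      omega
    have gmean : ∑ h ∈ Finset.range (s.M + 1), (h : ℝ) * gate s.ρ (a * s.q) h = a * s.q * s.mean := by
      rw [sum_mul_gate]; rfl
    have d := decAt_lconv_of_convClosedT convClosedT_holds y s.M (ftop L') (gate s.ρ (a * s.q)) (resid a (wco a L') L') hy0 hy1
      g0 gM g1 R0 RM R1
      (fun h hh => by
        rw [gmean]
        have hhM : h ≤ s.M := by by_contra hlt; exact absurd (gM h (not_le.1 hlt)) (ne_of_gt hh)
        have : y * (h : ℝ) ≤ y * (s.M : ℝ) := mul_le_mul_of_nonneg_left (by exact_mod_cast hhM) hy0.le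
        linarith)
      (fun h hh => by
        rw [Rmn]
        have hhM : h ≤ ftop L' := by by_contra hlt; exact absurd (RM h (not_le.1 hlt)) (ne_of_gt hh)
        have : y * (h : ℝ) ≤ y * (ftop L' : ℝ) := mul_le_mul_of_nonneg_left (by exact_mod_cast hhM) hy0.le
        linarith)
      hDs hD' j hj'
    rw [decAt_iff_decAtT, sum_mul_lconv s.M (ftop L') _ _ g1 R1, gmean, Rmn, ← hTeq] at d
    exact d
  -- component 2: the U-part
  have hUc : DECAtT y T j (s.M + ftop L') (gate (lconv s.M (ftop L') s.ρ H) (a * s.q)) := by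
    have hj' : j < s.M + ftop L' := by
      have : ftop (s :: L') = ftop L' + s.M := rfl
      omega
    have d := hU j hj'
    rw [decAt_iff_decAtT, sum_mul_gate, sum_mul_lconv s.M (ftop L') _ _ ρ1 H1, Hmn] at d
    have e : a * s.q * (∑ h ∈ Finset.range (s.M + 1), (h : ℝ) * s.ρ h + fmean L' / s.q) = T := by
      rw [hTeq]; show a * s.q * (s.mean + fmean L' / s.q) = _; field_simp
    rwa [e] at d
  -- the mixture
  have hp0 : 0 ≤ (r - w) / (1 - w) := div_nonneg (by linarith) (by linarith)
  have hp1 : (r - w) / (1 - w) ≤ 1 := by rw [div_le_one (by linarith)]; linarith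
  have mix := decAtT_mixture ((r - w) / (1 - w)) hp0 hp1 hconv hUc
  have e : resid a w (s :: L') = fun h => (r - w) / (1 - w) * lconv s.M (ftop L') (gate s.ρ (a * s.q)) (resid a (wco a L') L') h
      + (1 - (r - w) / (1 - w)) * gate (lconv s.M (ftop L') s.ρ H) (a * s.q) h := by
    funext h
    have key := resid_cons_recursion ha0 ha1 s t u L₂ ⟨hq0, hq1, ρ0, ρM, ρ1⟩ hL' hwco h
    have hne : (1 - w) ≠ 0 := by linarith
    rw [← hL'def, ← hwdef, ← hrdef] at key
    field_simp
    linear_combination key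
  have etop : ftop (s :: L') = s.M + ftop L' := by show ftop L' + s.M = _; omega
  rw [decAt_iff_decAtT, RRmn, etop, e]
  exact mix


end LawDec
end Quant
end Summit.CriticalPhenomena.PercolationContinuityZ3.Theorems
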